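import Summits.MatrixMultiplication.OmegaCensus.ThreeSetZpCells4Core
import Summits.MatrixMultiplication.OmegaCensus.ThreeSetLineParity
import HarnessLib

/-!
# Three-set cube cells `(4, d, e)@p²`: the PENCIL REDUCTION — the W-cover is automatic for every prime `p ≥ 5`

ω-census `pub-omega`, family (b3), seat pub-omega-group gen 40.  Framing: lottery ticket; floor = certified bounds/negative ranges.
VALUE: a kernel theorem about the group-theoretic method (TPP capacity of dihedral-like groups `Dih(A)`, `|A| = p²`), uniform in
the prime `p`; NOT progress on ω.  It isolates the one arithmetic statement — LINE LEMMA (β) — on which the whole `|W| = 4` column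
of the three-set cube census over `ℤ_p²` rests (`RESULTS-g39 §5a`), with no frame enumeration and no cover table.

**The pencil.**  For `k : ℕ` let `κ_k = {0, 0, 1, k}` be the 4-point line datum on `ℤ_p` with a doubled point (`pencilVec p k`, a
count vector).  `κ_1 = {0,0,1,1}` (type `(2,2)`) is inadmissible for every odd fibre size by parity
(`LineInv.no_line_identity3_of_even`); `κ_{p-1} = {−1, 0, 0, 1}` is the centrally symmetric datum (admissible in every computed
table); `κ_0 = {0,0,0,1}` is type `(1,3)`.

**Theorem (`pencil_cover`).**  For every prime `p ≥ 5` and every frame `W = {0, e₁, e₂, c}` of `ℤ_p²` (`c = (c₁, c₂)`), one of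
the three difference directions `e₁`, `e₂`, `e₁ - e₂` of the sub-frame `{0, e₁, e₂}` carries, after an affine normalisation, a
pencil datum `κ_k` with `k ≠ p - 1`: the form `u ↦ u₂` gives `{0,0,1,c₂}`; if `c₂ = −1` the form `u ↦ u₁` gives `{0,0,1,c₁}`; if
`c₁ = c₂ = −1` the form `u ↦ 1 − u₁ − u₂` gives `{1,0,0,3} = κ_3` (and `3 ≠ −1` as `p ≠ 4`, `3 ≠ 1` as `p ≠ 2`).  So the W-cover
hypothesis `hcov` of `ThreeSetZpFrame4` / `ThreeSetZpCells4Core` holds for the killer list `pencilKils p = [κ_0, …, κ_{p-2}]`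
with a six-line proof, for all `p` at once.

**Definition (`LineLemmaBeta p d e`).**  LINE LEMMA (β) at the prime `p` for the masses `(d, e)`: for every `k < p - 1`, `k ≠ 1`,
the datum `κ_k` admits no solution `(F, G, s)` (`F ∈ compsLit p d`, `G ≤ e`, hole `s`) of the three-set line identity
`Σ_u M_{κ_k,F}(τ,u) G(u) + [s = τ] = p` (`lineMat3`).  Verified by exact computation (desk, g39) at `p = 17, 19, 23, 29, 31` for the
census masses; no proof for general `p` is known (it is an integrality statement in `ℤ[ζ_p]`, `RESULTS-g39 §5b`).

**Corollaries (`no_cube_form_4_sq_of_beta`, `no_law_cube_4de_sq_of_beta`, `no_law_cube_four_d_sq_of_beta`).**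
`LineLemmaBeta p d e` ⇒ no cube symmetric form with `|W| = 4`, `|X| = d`, `|Y| = e` over any `A` with `|A| = p²`, `A ↠ ℤ_p²`, hence
(`12de + 1 = p²`) no TPP triple of a dihedral-like group over `A` with balanced coset parts and a part `4` next to a part `d` attains
`3|S||T||U| + 8 = 8|A|`.  (The per-cell kernel files `ThreeSetZ17Cells446`, `ThreeSetZ19Cells456`, `ThreeSetZ23Cells4411` use
cheaper GREEDY covers with 3–4 killers instead; this file is the uniform statement.)
-/

namespace Summit.MatrixMultiplication.OmegaCensus

open Finset ZpZpDomino

namespace ZpPencil4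

/-! ## The pencil data as count vectors -/

/-- The pencil line datum `κ_k = {0, 0, 1, k}` on `ℤ_p` as a count vector (a list of length `p`). [folklore] -/
def pencilVec (p k : ℕ) : List ℕ :=
  (List.range p).map fun v => (if v = 0 then 2 else 0) + (if v = 1 then 1 else 0) + (if v = k then 1 else 0)

/-- The pencil killer list `[κ_0, κ_1, …, κ_{p-2}]` (every `κ_k` except the symmetric `κ_{p-1}`). [folklore] -/
def pencilKils (p : ℕ) : List (List ℕ) := (List.range (p - 1)).map (pencilVec p)

/-- Entry `k < p - 1` of the pencil killer list is `κ_k`. [folklore] -/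
theorem pencilKils_getD (p k : ℕ) (hk : k < p - 1) : (pencilKils p).getD k [] = pencilVec p k := by
  unfold pencilKils
  rw [List.getD_eq_getElem?_getD, List.getElem?_map, List.getElem?_range hk]
  rfl

/-- The entries of `κ_k`: `2` at `0`, plus `1` at `1`, plus `1` at `k`. [folklore] -/
theorem pencilVec_getD (p k v : ℕ) (hv : v < p) :
    (pencilVec p k).getD v 0 = (if v = 0 then 2 else 0) + (if v = 1 then 1 else 0) + (if v = k then 1 else 0) := by
  unfold pencilVec
  rw [List.getD_eq_getElem?_getD, List.getElem?_map, List.getElem?_range hv]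
  rfl

/-- Every entry of `κ_1 = {0,0,1,1}` is even. [folklore] -/
theorem two_dvd_pencilVec_one_getD (p v : ℕ) : 2 ∣ (pencilVec p 1).getD v 0 := by
  by_cases hv : v < p
  · rw [pencilVec_getD p 1 v hv]
    by_cases h0 : v = 0
    · subst h0; simp
    · by_cases h1 : v = 1
      · subst h1; simp
      · simp [h0, h1]
  · unfold pencilVec
    rw [List.getD_eq_getElem?_getD, List.getElem?_eq_none_iff.mpr (by simp; omega), Option.getD_none]
    exact dvd_zero 2

/-! ## The W-cover is automatic -/

section Cover

variable {p : ℕ}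

/-- Arithmetic of the third case: `(p-1)² + (p-1)² + 1 ≡ 3 (mod p)` for `p ≥ 5`. [folklore] -/
theorem diag_case_mod (hp5 : 5 ≤ p) : ((p - 1) * (p - 1) + (p - 1) * (p - 1) + 1) % p = 3 := by
  obtain ⟨n, rfl⟩ := Nat.exists_eq_add_of_le hp5
  have h1 : 5 + n - 1 = n + 4 := by omega
  rw [h1]
  have h2 : (n + 4) * (n + 4) + (n + 4) * (n + 4) + 1 = 3 + (5 + n) * (2 * n + 6) := by ring
  rw [h2, Nat.add_mul_mod_self_left]
  exact Nat.mod_eq_of_lt (by omega)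

/-- **The pencil W-cover** (hypothesis `hcov` of `ThreeSetZpFrame4.exists_killer_line_core` for the killer list `pencilKils p`):
every frame `{0, e₁, e₂, (c₁, c₂)}` of `ℤ_p²`, `p ≥ 5`, has a non-zero line form and a shift under which its datum is some
`κ_k`, `k < p - 1`. [folklore] -/
theorem pencil_cover (hp5 : 5 ≤ p) (ci : ℕ) (hci : ci < p * p) (_h : ¬(ci = 0 ∨ ci = 1 ∨ ci = p)) :
    ∃ a b β k : ℕ, (a ≠ 0 ∨ b ≠ 0) ∧ a < p ∧ b < p ∧ β < p ∧ k < p - 1 ∧ ∀ v, v < p →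
      ((if β % p = v then 1 else 0) + (if (a + β) % p = v then 1 else 0) + (if (b + β) % p = v then 1 else 0) +
        (if (a * (ci / p) + b * (ci % p) + β) % p = v then 1 else 0)) = ((pencilKils p).getD k []).getD v 0 := by
  have hp1 : 1 < p := by omega
  have hc2 : ci % p < p := Nat.mod_lt _ (by omega)
  have hc1 : ci / p < p := Nat.div_lt_of_lt_mul hci
  by_cases h2 : ci % p = p - 1
  · by_cases h1 : ci / p = p - 1
    · -- the diagonal frame `c = (-1, -1)`: form `(p-1, p-1)`, shift `1`, datum `{1, 0, 0, 3} = κ_3`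
      refine ⟨p - 1, p - 1, 1, 3, Or.inl (by omega), by omega, by omega, hp1, by omega, fun v hv => ?_⟩
      rw [pencilKils_getD p 3 (by omega), pencilVec_getD p 3 v hv, h1, h2]
      have e1 : 1 % p = 1 := Nat.mod_eq_of_lt hp1
      have e2 : (p - 1 + 1) % p = 0 := by rw [show p - 1 + 1 = p by omega, Nat.mod_self]
      have e3 : ((p - 1) * (p - 1) + (p - 1) * (p - 1) + 1) % p = 3 := diag_case_mod hp5
      simp only [e1, e2, e3]
      split_ifs <;> omega
    · -- `c₂ = -1`, `c₁ ≠ -1`: form `u ↦ u₁`, datum `{0, 1, 0, c₁} = κ_{c₁}`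
      refine ⟨1, 0, 0, ci / p, Or.inl one_ne_zero, hp1, by omega, by omega, by omega, fun v hv => ?_⟩
      rw [pencilKils_getD p (ci / p) (by omega), pencilVec_getD p (ci / p) v hv]
      have e1 : (1 + 0) % p = 1 := Nat.mod_eq_of_lt hp1
      have e2 : (0 + 0) % p = 0 := Nat.zero_mod p
      have e3 : (1 * (ci / p) + 0 * (ci % p) + 0) % p = ci / p := by
        rw [one_mul, zero_mul, Nat.add_zero, Nat.add_zero]; exact Nat.mod_eq_of_lt hc1
      simp only [e1, e2, e3]
      split_ifs <;> omega
  · -- `c₂ ≠ -1`: form `u ↦ u₂`, datum `{0, 0, 1, c₂} = κ_{c₂}`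
    refine ⟨0, 1, 0, ci % p, Or.inr one_ne_zero, by omega, hp1, by omega, by omega, fun v hv => ?_⟩
    rw [pencilKils_getD p (ci % p) (by omega), pencilVec_getD p (ci % p) v hv]
    have e1 : (1 + 0) % p = 1 := Nat.mod_eq_of_lt hp1
    have e2 : (0 + 0) % p = 0 := Nat.zero_mod p
    have e3 : (0 * (ci / p) + 1 * (ci % p) + 0) % p = ci % p := by
      rw [one_mul, zero_mul, Nat.zero_add, Nat.add_zero]; exact Nat.mod_eq_of_lt hc2
    simp only [e1, e2, e3]
    split_ifs <;> omega

end Cover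

/-! ## LINE LEMMA (β) and the reduction -/

/-- **LINE LEMMA (β) at the prime `p` for the masses `(d, e)`** (a `Prop`; verified exactly at `p ≤ 31` for the census masses,
open in general): every pencil datum `κ_k = {0,0,1,k}`, `k < p - 1`, `k ≠ 1`, admits no solution of the three-set line identity
with `X`-datum of mass `d`, `Y`-datum bounded by `e` and constant `p`. [folklore] -/
def LineLemmaBeta (p : ℕ) [NeZero p] (d e : ℕ) : Prop :=
  ∀ k, k < p - 1 → k ≠ 1 → ∀ Fl ∈ ZpZpDomino.compsLit p d, ∀ (G : ZMod p → ℕ) (s : ZMod p), (∀ u, G u ≤ e) →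
    ¬ ∀ τ : ZMod p, (∑ u : ZMod p, lineMat3 (vecFn (pencilVec p k)) (vecFn Fl) τ u * G u) + (if s = τ then 1 else 0) = p

section Reduction

variable {p : ℕ} [Fact p.Prime]

/-- **The pencil killer facts** (hypothesis `hkill` of `ThreeSetZpCells4Core` for `pencilKils p`) from LINE LEMMA (β):
`κ_1` by parity, the rest by (β). [folklore] -/
theorem pencil_killers (hp5 : 5 ≤ p) {d e : ℕ} (hβ : LineLemmaBeta p d e) :
    ∀ k, k < p - 1 → ∀ Fl ∈ ZpZpDomino.compsLit p d, ∀ (G : ZMod p → ℕ) (s : ZMod p), (∀ u, G u ≤ e) →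
      ¬ ∀ τ : ZMod p, (∑ u : ZMod p, lineMat3 (vecFn ((pencilKils p).getD k [])) (vecFn Fl) τ u * G u) +
        (if s = τ then 1 else 0) = p := by
  intro k hk Fl hFl G s hG hid
  rw [pencilKils_getD p k hk] at hid
  by_cases h1 : k = 1
  · subst h1
    have hodd : p % 2 = 1 := ((Fact.out : p.Prime).eq_two_or_odd).resolve_left (by omega)
    exact LineInv.no_line_identity3_of_even (W := vecFn (pencilVec p 1))
      (fun v => two_dvd_pencilVec_one_getD p v.val) hodd (by omega) (vecFn Fl) G s hid
  · exact hβ k hk h1 Fl hFl G s hG hid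

variable {A : Type*} [AddCommGroup A] [Fintype A] [DecidableEq A]

/-- **LINE LEMMA (β) ⇒ no cube symmetric form with a part of size `4`** (`|W| = 4`, `|X| = d`, `|Y| = e`) over `|A| = p²`,
`A ↠ ℤ_p²`, `p ≥ 5` — no cover table, no frame enumeration. [folklore] -/
theorem no_cube_form_4_sq_of_beta (hp5 : 5 ≤ p) {d e : ℕ} (hβ : LineLemmaBeta p d e)
    (hA : Fintype.card A = p * p) (Φ : A →+ ZMod p × ZMod p)
    (hΦ : Function.Surjective Φ) {W X Y : Finset A} {x₀ : A} (hW : W.card = 4) (hX : X.card = d) (hY : Y.card = e)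
    (h₁ : Set.InjOn (fun p : A × A × A => -p.1 + p.2.1 + p.2.2) ↑(W ×ˢ X ×ˢ Y))
    (h₂ : Set.InjOn (fun p : A × A × A => p.1 - p.2.1 + p.2.2) ↑(W ×ˢ X ×ˢ Y))
    (h₃ : Set.InjOn (fun p : A × A × A => p.1 + p.2.1 - p.2.2) ↑(W ×ˢ X ×ˢ Y))
    (d₁₂ : Disjoint ((W ×ˢ X ×ˢ Y).image fun p : A × A × A => -p.1 + p.2.1 + p.2.2)
      ((W ×ˢ X ×ˢ Y).image fun p : A × A × A => p.1 - p.2.1 + p.2.2))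
    (d₁₃ : Disjoint ((W ×ˢ X ×ˢ Y).image fun p : A × A × A => -p.1 + p.2.1 + p.2.2)
      ((W ×ˢ X ×ˢ Y).image fun p : A × A × A => p.1 + p.2.1 - p.2.2))
    (d₂₃ : Disjoint ((W ×ˢ X ×ˢ Y).image fun p : A × A × A => p.1 - p.2.1 + p.2.2)
      ((W ×ˢ X ×ˢ Y).image fun p : A × A × A => p.1 + p.2.1 - p.2.2))
    (hcover : ((W ×ˢ X ×ˢ Y).image fun p : A × A × A => -p.1 + p.2.1 + p.2.2) ∪
      ((W ×ˢ X ×ˢ Y).image fun p : A × A × A => p.1 - p.2.1 + p.2.2) ∪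
      ((W ×ˢ X ×ˢ Y).image fun p : A × A × A => p.1 + p.2.1 - p.2.2) = univ.erase x₀) : False :=
  no_cube_form_4_sq_of_killers hp5 (pencilKils p) (fun ci hci h => pencil_cover hp5 ci hci h) (pencil_killers hp5 hβ)
    hA Φ hΦ hW hX hY h₁ h₂ h₃ d₁₂ d₁₃ d₂₃ hcover

end Reduction

/-! ## The TPP statements modulo LINE LEMMA (β) -/

section DihedralLike

variable {p : ℕ} [Fact p.Prime] {A : Type} [AddCommGroup A] [DecidableEq A] [Fintype A] {G : Type} [Group G]
  [DecidableEq G] {ρ τ : A → G} {c₀ : A} {S T U : Finset G}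

open Literature.Combinatorics.Additive

/-- **LINE LEMMA (β) ⇒ no `(4,4 | d,d | e,e)` law triple over `|A| = p²`, `A ↠ ℤ_p²`** (dihedral-like `G`, any `c₀`;
`12de + 1 = p²`, `p ≥ 5`). [folklore] -/
theorem no_law_cube_4de_sq_of_beta (hp5 : 5 ≤ p) {d e : ℕ} (hde : 12 * (d * e) + 1 = p * p) (hβ : LineLemmaBeta p d e)
    (hA : Fintype.card A = p * p)
    (hρρ : ∀ a b, ρ a * ρ b = ρ (a + b)) (hρτ : ∀ a b, ρ a * τ b = τ (b - a))
    (hτρ : ∀ a b, τ a * ρ b = τ (a + b)) (hττ : ∀ a b, τ a * τ b = ρ (c₀ + b - a))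
    (hρ : Function.Injective ρ) (hτ : Function.Injective τ) (hne : ∀ a b, ρ a ≠ τ b)
    (hsurj : ∀ g, (∃ a, ρ a = g) ∨ (∃ a, τ a = g))
    (Φ : A →+ ZMod p × ZMod p) (hΦ : Function.Surjective Φ)
    (h : TripleProductProperty S T U)
    (hS₀ : (univ.filter fun a : A => ρ a ∈ S).card = 4) (hS₁ : (univ.filter fun a : A => τ a ∈ S).card = 4)
    (hT₀ : (univ.filter fun a : A => ρ a ∈ T).card = d) (hT₁ : (univ.filter fun a : A => τ a ∈ T).card = d)
    (hU : (univ.filter fun a : A => ρ a ∈ U).card = (univ.filter fun a : A => τ a ∈ U).card)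
    (hV : 3 * (S.card * T.card * U.card) + 8 = 8 * Fintype.card A) : False :=
  no_law_cube_4de_sq_of_killers hp5 hde (pencilKils p) (fun ci hci h => pencil_cover hp5 ci hci h)
    (pencil_killers hp5 hβ) hA hρρ hρτ hτρ hττ hρ hτ hne hsurj Φ hΦ h hS₀ hS₁ hT₀ hT₁ hU hV

/-- **LINE LEMMA (β) ⇒ cell form `(4,d,·)@p²` in all orderings**: balanced coset parts with a part `4` next to a part `d`
(cyclically, either order) ⇒ `3|S||T||U| + 8 ≠ 8|A|` over `|A| = p²`, `A ↠ ℤ_p²`, `p ≥ 5`. [folklore] -/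
theorem no_law_cube_four_d_sq_of_beta (hp5 : 5 ≤ p) {d e : ℕ} (hde : 12 * (d * e) + 1 = p * p)
    (hβ : LineLemmaBeta p d e) (hA : Fintype.card A = p * p)
    (hρρ : ∀ a b, ρ a * ρ b = ρ (a + b)) (hρτ : ∀ a b, ρ a * τ b = τ (b - a))
    (hτρ : ∀ a b, τ a * ρ b = τ (a + b)) (hττ : ∀ a b, τ a * τ b = ρ (c₀ + b - a))
    (hρ : Function.Injective ρ) (hτ : Function.Injective τ) (hne : ∀ a b, ρ a ≠ τ b)
    (hsurj : ∀ g, (∃ a, ρ a = g) ∨ (∃ a, τ a = g))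
    (Φ : A →+ ZMod p × ZMod p) (hΦ : Function.Surjective Φ)
    (h : TripleProductProperty S T U)
    (hS : (univ.filter fun a : A => ρ a ∈ S).card = (univ.filter fun a : A => τ a ∈ S).card)
    (hT : (univ.filter fun a : A => ρ a ∈ T).card = (univ.filter fun a : A => τ a ∈ T).card)
    (hU : (univ.filter fun a : A => ρ a ∈ U).card = (univ.filter fun a : A => τ a ∈ U).card)
    (h4d : ((univ.filter fun a : A => ρ a ∈ S).card = 4 ∧ (univ.filter fun a : A => ρ a ∈ T).card = d) ∨
      ((univ.filter fun a : A => ρ a ∈ T).card = 4 ∧ (univ.filter fun a : A => ρ a ∈ U).card = d) ∨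
      ((univ.filter fun a : A => ρ a ∈ U).card = 4 ∧ (univ.filter fun a : A => ρ a ∈ S).card = d) ∨
      ((univ.filter fun a : A => ρ a ∈ S).card = d ∧ (univ.filter fun a : A => ρ a ∈ T).card = 4) ∨
      ((univ.filter fun a : A => ρ a ∈ T).card = d ∧ (univ.filter fun a : A => ρ a ∈ U).card = 4) ∨
      ((univ.filter fun a : A => ρ a ∈ U).card = d ∧ (univ.filter fun a : A => ρ a ∈ S).card = 4)) :
    3 * (S.card * T.card * U.card) + 8 ≠ 8 * Fintype.card A :=
  no_law_cube_four_d_sq_of_killers hp5 hde (pencilKils p) (fun ci hci h => pencil_cover hp5 ci hci h)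
    (pencil_killers hp5 hβ) hA hρρ hρτ hτρ hττ hρ hτ hne hsurj Φ hΦ h hS hT hU h4d

end DihedralLike

end ZpPencil4

end Summit.MatrixMultiplication.OmegaCensus
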